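import Summits.QuantumFields.YangMills.Theorems.SwapVirialDeficitBlowUpVirialDeficitPowers
import HarnessLib

/-!
# GOOD HUBS: all POWERS of the hub-soft leaders' Euler weights against `F̂^p`, and their window-uniform a-priori size
# (free-hands support of ⟨stmt-QuantumFields-24197⟩ `SwapVirialDeficit.SwapGluedStiffness`; companion of ✓`…BlowUpVirialDeficitPowers`)

On the GOOD hubs `{θ ≤ sin²2ψ}` (letter `x`) and `{θ ≤ sin²ψ}` (letter `y`), `sin ψ = ‖Im a‖/‖a‖`, `cos ψ = Re a/‖a‖`, w2 g57's pointwise hub-stiffness bounds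
✓`hubStiff_mul_gnoWtr_x_le` ∕ ✓`hubStiff_mul_gnoWtr_y_le` (and ✓`gnomonicW_z_le` for the stiff letter `z`) give `W ≤ 7200·L⁶/θ·F̂₀`, hence for EVERY power `p > 0`
`W^p ≤ (7200L⁶/θ)^p·F̂₀^p`; the socket ✓`chartTerm_le_of_le_mul_rpow_deficit` and the window-uniform moments ✓`swap_deficit_rpow_moment_le` then bound the good-hub
transverse moments of the leaders at the a-priori scale:

* `measurable_hubStiff_x`, `measurable_hubStiff_y`, `measurable_gnoWtr`; `indicator_gnoWtr_x_le`, `indicator_gnoWtr_y_le` (`𝟙_{good}·W ≤ (c/θ)L⁶F̂₀`, hub `a ≠ 0`);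
* ★★ `leadersW_rpow_goodHub_term_le` — `0 < θ ≤ 1`, `p > 0`, `b > 0`:
  `K_L·∫_cone Σ_ε ∫ (𝟙_{θ≤sin²2ψ}W(x)^p + 𝟙_{θ≤sin²ψ}W(y)^p + W(z)^p)·e^{−bF̂₀}ρ ≤ 3·(7200L⁶/θ)^p·∫ F₀^p e^{−bF₀} dμ_L`;
* ★★★ `leadersW_rpow_goodHub_term_apriori` — ABSOLUTE `C, β₁`: the same `≤ 3·(7200L⁶/θ)^p·e·(C·p·L⁴(1 + log L + log b)/b)^p·Z₀(b)`, every `L`, `b ≥ β₁`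
  (e.g. `p = 3/2`, `θ = b^{−1/4}`: `β·(…) = O(L^{15}(log b)^{3/2} b^{−1/8})·Z₀ = o(1)·Z₀` on a window — the good-hub cubic moments of fcl-p3 g46 memo2 §3).
The `p = 1` weight itself (good AND bad hubs, the latter as a fibre-mass term) is fcl-p3 g46's ⧗/✓`softW_term_le`; not restated here.

HONEST LABEL: crude window-uniform bookkeeping on the GOOD hubs only; the bad hubs ((HM), a one-loop-uniformity statement by fcl-p3 g46 memo3), the valley structure of
`R` and ⟨24197⟩ (window-uniform) ∕ ⟨24194⟩ ∕ ⟨24196⟩ ∕ ⟨24497⟩ stay OPEN; own crux ⟨22884⟩ OPEN (blocked-on ⟨19935⟩); no crux, rung of record or summit is proved; the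
Yang–Mills mass gap is NOT proved; no summit is proved by a line.  THEOREMS ONLY (0 `def`, 0 `sorry`), standard axioms; the series' local `ℍ` instances.
Width seat ym-line-sfw-p2-w3 g65 (cell ym-idea-1, free hands), `--supports stmt-QuantumFields-24197`.  References: [cite: Luscher1983, §2]; [cite: Griffiths1964]; [folklore].
-/

set_option autoImplicit false
set_option synthInstance.maxSize 1024

noncomputable section

open MeasureTheory Quaternion Set Filter Topology
open scoped Quaternion BigOperators
open Literature.MathematicalPhysics.QuantumLattice
open Literature.MathematicalPhysics.QuantumFieldTheory hiding SU2
open Summit.QuantumFields.YangMills.Theorems.FemtoTransferGap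
open Summit.QuantumFields.YangMills.Theorems.FemtoTransferGap.TT
open Summit.QuantumFields.YangMills.Theorems.VirialFluxGap.RingDeficit
open Summit.QuantumFields.YangMills.Theorems.SwapTwistDeficit.ToronLog (coneMeasure coneConst coneConst_pos isProbabilityMeasure_coneMeasure)
open Summit.QuantumFields.YangMills.Theorems.SwapVirialDeficit.SwapRing
open Summit.QuantumFields.YangMills.Theorems.SwapVirialDeficit.Gnomonic (gnomonicW gnomonicW_nonneg_le)
open Summit.QuantumFields.YangMills.Theorems.SwapVirialDeficit.ZeroModeSigma (ae_ne_zero_coneMeasure)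

attribute [local instance] Literature.Analysis.FluidPDE.Tao2016.quatMeasurableSpace
  Literature.Analysis.FluidPDE.Tao2016.quatBorelSpace
  Literature.MathematicalPhysics.QuantumLattice.secondCountableTopology_su2

namespace Summit.QuantumFields.YangMills.Theorems.SwapVirialDeficit.BlowUpRing

variable {L : ℕ} [NeZero L]

/-! ## Good hubs: the hub-soft leaders' weights where the hub stiffness is at least `θ` -/

section GoodHub

/-- The `x`-stiffness `sin²2ψ = (2·(Re a/‖a‖)·(‖Im a‖/‖a‖))²` is a measurable function of the hub. [folklore] -/
theorem measurable_hubStiff_x : Measurable fun a : ℍ => (2 * (‖a‖⁻¹ * a.re) * (‖a‖⁻¹ * ‖a.im‖)) ^ 2 := by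
  have h1 : Measurable fun a : ℍ => ‖a‖⁻¹ := measurable_norm.inv
  have h2 : Measurable fun a : ℍ => a.re := Quaternion.continuous_re.measurable
  have h3 : Measurable fun a : ℍ => ‖a.im‖ := (Quaternion.continuous_im.norm).measurable
  exact ((measurable_const.mul (h1.mul h2)).mul (h1.mul h3)).pow_const 2

/-- The `y`-stiffness `sin²ψ = (‖Im a‖/‖a‖)²` is a measurable function of the hub. [folklore] -/
theorem measurable_hubStiff_y : Measurable fun a : ℍ => (‖a‖⁻¹ * ‖a.im‖) ^ 2 :=
  (measurable_norm.inv.mul (Quaternion.continuous_im.norm).measurable).pow_const 2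

/-- `gnoWtr` is measurable. [folklore] -/
theorem measurable_gnoWtr : Measurable gnoWtr := continuous_gnoWtr.measurable

variable {θ : ℝ}

/-- On a good `x`-hub (`θ ≤ sin²2ψ`, `θ > 0`, `a ≠ 0`): `𝟙·W(x) ≤ (7200L⁶/θ)·F̂₀` (✓`hubStiff_mul_gnoWtr_x_le`). [cite: Luscher1983, §2] -/
theorem indicator_gnoWtr_x_le (hθ : 0 < θ) {a : ℍ} (ha : a ≠ 0) (ε : GnoSign L) (η : GnoCoord L) :
    Set.indicator {a : ℍ | θ ≤ (2 * (‖a‖⁻¹ * a.re) * (‖a‖⁻¹ * ‖a.im‖)) ^ 2} (fun _ => (1 : ℝ)) a * gnoWtr η.1.1 ≤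
      7200 * (L : ℝ) ^ 6 / θ * gnoDeficit (fun _ => false) (fun _ => 1) a ε η := by
  have hF0 := gnoDeficit_nonneg (fun _ => false) (fun _ => (1 : SU2)) a ε η
  obtain ⟨hW0, -⟩ := gnoWtr_nonneg_le η.1.1
  by_cases hmem : a ∈ {a : ℍ | θ ≤ (2 * (‖a‖⁻¹ * a.re) * (‖a‖⁻¹ * ‖a.im‖)) ^ 2}
  · rw [Set.indicator_of_mem hmem, one_mul]
    have hs : θ ≤ (2 * (‖a‖⁻¹ * a.re) * (‖a‖⁻¹ * ‖a.im‖)) ^ 2 := hmem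
    have h := hubStiff_mul_gnoWtr_x_le (L := L) ha ε η
    change (2 * (‖a‖⁻¹ * a.re) * (‖a‖⁻¹ * ‖a.im‖)) ^ 2 * gnoWtr η.1.1 ≤ 7200 * (L : ℝ) ^ 6 * gnoDeficit (fun _ => false) (fun _ => 1) a ε η at h
    rw [div_mul_eq_mul_div, le_div_iff₀ hθ]
    calc gnoWtr η.1.1 * θ ≤ gnoWtr η.1.1 * (2 * (‖a‖⁻¹ * a.re) * (‖a‖⁻¹ * ‖a.im‖)) ^ 2 := mul_le_mul_of_nonneg_left hs hW0
      _ ≤ 7200 * (L : ℝ) ^ 6 * gnoDeficit (fun _ => false) (fun _ => 1) a ε η := by rw [mul_comm]; exact h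
  · rw [Set.indicator_of_notMem hmem, zero_mul]
    positivity

/-- On a good `y`-hub (`θ ≤ sin²ψ`, `θ > 0`, `a ≠ 0`): `𝟙·W(y) ≤ (1800L⁶/θ)·F̂₀` (✓`hubStiff_mul_gnoWtr_y_le`). [cite: Luscher1983, §2] -/
theorem indicator_gnoWtr_y_le (hθ : 0 < θ) {a : ℍ} (ha : a ≠ 0) (ε : GnoSign L) (η : GnoCoord L) :
    Set.indicator {a : ℍ | θ ≤ (‖a‖⁻¹ * ‖a.im‖) ^ 2} (fun _ => (1 : ℝ)) a * gnoWtr η.1.2 ≤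
      1800 * (L : ℝ) ^ 6 / θ * gnoDeficit (fun _ => false) (fun _ => 1) a ε η := by
  have hF0 := gnoDeficit_nonneg (fun _ => false) (fun _ => (1 : SU2)) a ε η
  obtain ⟨hW0, -⟩ := gnoWtr_nonneg_le η.1.2
  by_cases hmem : a ∈ {a : ℍ | θ ≤ (‖a‖⁻¹ * ‖a.im‖) ^ 2}
  · rw [Set.indicator_of_mem hmem, one_mul]
    have hs : θ ≤ (‖a‖⁻¹ * ‖a.im‖) ^ 2 := hmem
    have h := hubStiff_mul_gnoWtr_y_le (L := L) ha ε η
    change (‖a‖⁻¹ * ‖a.im‖) ^ 2 * gnoWtr η.1.2 ≤ 1800 * (L : ℝ) ^ 6 * gnoDeficit (fun _ => false) (fun _ => 1) a ε η at h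
    rw [div_mul_eq_mul_div, le_div_iff₀ hθ]
    calc gnoWtr η.1.2 * θ ≤ gnoWtr η.1.2 * (‖a‖⁻¹ * ‖a.im‖) ^ 2 := mul_le_mul_of_nonneg_left hs hW0
      _ ≤ 1800 * (L : ℝ) ^ 6 * gnoDeficit (fun _ => false) (fun _ => 1) a ε η := by rw [mul_comm]; exact h
  · rw [Set.indicator_of_notMem hmem, zero_mul]
    positivity

/-- ★★ **GOOD-HUB POWERS OF THE LEADERS' WEIGHTS AGAINST `F̂^p`**: for `0 < θ ≤ 1`, `p > 0`, `b > 0`, every `L`,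
`K_L·∫_cone Σ_ε ∫ (𝟙_{θ≤sin²2ψ}·W(x)^p + 𝟙_{θ≤sin²ψ}·W(y)^p + W(z)^p)·e^{−bF̂₀}ρ ≤ 3·(7200·L⁶/θ)^p · ∫ F₀^p e^{−bF₀} dμ_L`
(pointwise `W ≤ 7200L⁶F̂/θ` on the good hub for each of the three letters, ✓`gnomonicW_z_le` for `z` with no hub condition). [cite: Luscher1983, §2] -/
theorem leadersW_rpow_goodHub_term_le (hθ : 0 < θ) (hθ1 : θ ≤ 1) {p : ℝ} (hp : 0 < p) {b : ℝ} (hb : 0 < b) :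
    (coneConst ^ 3 / 64 * (1 / (2 * Real.pi ^ 2)) ^ Fintype.card (Fol L)) *
        ∫ a, (∑ ε : GnoSign L, ∫ η : GnoCoord L,
          (Set.indicator {a : ℍ | θ ≤ (2 * (‖a‖⁻¹ * a.re) * (‖a‖⁻¹ * ‖a.im‖)) ^ 2} (fun _ => (1 : ℝ)) a * gnoWtr η.1.1 ^ p +
            Set.indicator {a : ℍ | θ ≤ (‖a‖⁻¹ * ‖a.im‖) ^ 2} (fun _ => (1 : ℝ)) a * gnoWtr η.1.2 ^ p + gnomonicW η.2.1 ^ p) *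
          Real.exp (-(b * gnoDeficit (fun _ => false) (fun _ => 1) a ε η)) * gnoDensity η) ∂coneMeasure ≤
      3 * (7200 * (L : ℝ) ^ 6 / θ) ^ p *
        ∫ q, swapRingDeficit L (fun _ => false) q ^ p * Real.exp (-(b * swapRingDeficit L (fun _ => false) q)) ∂(ringMeasure L) := by
  have hSx : MeasurableSet {a : ℍ | θ ≤ (2 * (‖a‖⁻¹ * a.re) * (‖a‖⁻¹ * ‖a.im‖)) ^ 2} := measurableSet_le measurable_const measurable_hubStiff_x
  have hSy : MeasurableSet {a : ℍ | θ ≤ (‖a‖⁻¹ * ‖a.im‖) ^ 2} := measurableSet_le measurable_const measurable_hubStiff_y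
  have hL1 : (1 : ℝ) ≤ L := by exact_mod_cast NeZero.one_le
  have hK0 : 0 ≤ 7200 * (L : ℝ) ^ 6 / θ := by positivity
  -- the common constant `7200 L⁶/θ` dominates each letter's stiffness constant (`θ ≤ 1` for `z`)
  have hKx : 7200 * (L : ℝ) ^ 6 / θ ≤ 7200 * (L : ℝ) ^ 6 / θ := le_rfl
  have hKy : 1800 * (L : ℝ) ^ 6 / θ ≤ 7200 * (L : ℝ) ^ 6 / θ := by gcongr; norm_num
  have hKz : 7200 * (L : ℝ) ^ 6 ≤ 7200 * (L : ℝ) ^ 6 / θ := by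
    rw [le_div_iff₀ hθ]; nlinarith [pow_nonneg (zero_le_one.trans hL1) 6]
  refine chartTerm_le_of_le_mul_rpow_deficit (L := L) (fun _ => false) (b := b) (c := 3 * (7200 * (L : ℝ) ^ 6 / θ) ^ p) (M := 3 * 4 ^ p)
    (g := fun _ q => Set.indicator {a : ℍ | θ ≤ (2 * (‖a‖⁻¹ * a.re) * (‖a‖⁻¹ * ‖a.im‖)) ^ 2} (fun _ => (1 : ℝ)) q.1 * gnoWtr q.2.1.1 ^ p +
      Set.indicator {a : ℍ | θ ≤ (‖a‖⁻¹ * ‖a.im‖) ^ 2} (fun _ => (1 : ℝ)) q.1 * gnoWtr q.2.1.2 ^ p + gnomonicW q.2.2.1 ^ p)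
    (fun _ => ((((measurable_const.indicator hSx).comp measurable_fst).mul
        ((measurable_gnoWtr.comp (measurable_fst.comp (measurable_fst.comp measurable_snd))).pow_const p)).add
      (((measurable_const.indicator hSy).comp measurable_fst).mul
        ((measurable_gnoWtr.comp (measurable_snd.comp (measurable_fst.comp measurable_snd))).pow_const p))).add
      ((measurable_zW.comp measurable_snd).pow_const p))
    (fun _ q => ?_) (fun ε a η ha => ?_) hb.le hp
  · -- boundedness: each summand in `[0, 4^p]`
    obtain ⟨h0x, h4x⟩ := gnoWtr_nonneg_le q.2.1.1
    obtain ⟨h0y, h4y⟩ := gnoWtr_nonneg_le q.2.1.2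
    obtain ⟨h0z, h4z⟩ := gnomonicW_nonneg_le q.2.2.1
    have px : gnoWtr q.2.1.1 ^ p ≤ 4 ^ p := Real.rpow_le_rpow h0x h4x hp.le
    have py : gnoWtr q.2.1.2 ^ p ≤ 4 ^ p := Real.rpow_le_rpow h0y h4y hp.le
    have pz : gnomonicW q.2.2.1 ^ p ≤ 4 ^ p := Real.rpow_le_rpow h0z h4z hp.le
    have px0 : 0 ≤ gnoWtr q.2.1.1 ^ p := Real.rpow_nonneg h0x _
    have py0 : 0 ≤ gnoWtr q.2.1.2 ^ p := Real.rpow_nonneg h0y _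
    have pz0 : 0 ≤ gnomonicW q.2.2.1 ^ p := Real.rpow_nonneg h0z _
    have i1 : 0 ≤ Set.indicator {a : ℍ | θ ≤ (2 * (‖a‖⁻¹ * a.re) * (‖a‖⁻¹ * ‖a.im‖)) ^ 2} (fun _ => (1 : ℝ)) q.1 ∧
        Set.indicator {a : ℍ | θ ≤ (2 * (‖a‖⁻¹ * a.re) * (‖a‖⁻¹ * ‖a.im‖)) ^ 2} (fun _ => (1 : ℝ)) q.1 ≤ 1 :=
      ⟨Set.indicator_nonneg (fun _ _ => zero_le_one) _, Set.indicator_le_self' (fun _ _ => zero_le_one) _⟩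
    have i2 : 0 ≤ Set.indicator {a : ℍ | θ ≤ (‖a‖⁻¹ * ‖a.im‖) ^ 2} (fun _ => (1 : ℝ)) q.1 ∧
        Set.indicator {a : ℍ | θ ≤ (‖a‖⁻¹ * ‖a.im‖) ^ 2} (fun _ => (1 : ℝ)) q.1 ≤ 1 :=
      ⟨Set.indicator_nonneg (fun _ _ => zero_le_one) _, Set.indicator_le_self' (fun _ _ => zero_le_one) _⟩
    have h4p : (0 : ℝ) ≤ 4 ^ p := Real.rpow_nonneg (by norm_num) _
    rw [abs_le]; constructor <;> nlinarith [mul_nonneg i1.1 px0, mul_nonneg i2.1 py0, mul_le_mul i1.2 px px0 zero_le_one,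
      mul_le_mul i2.2 py py0 zero_le_one]
  · -- pointwise: each summand `≤ (7200L⁶/θ)^p F̂^p`
    set F : ℝ := gnoDeficit (fun _ => false) (fun _ => (1 : SU2)) a ε η with hFdef
    have hF0 : 0 ≤ F := gnoDeficit_nonneg _ _ a ε η
    obtain ⟨h0x, -⟩ := gnoWtr_nonneg_le η.1.1
    obtain ⟨h0y, -⟩ := gnoWtr_nonneg_le η.1.2
    obtain ⟨h0z, -⟩ := gnomonicW_nonneg_le η.2.1
    have hx := indicator_gnoWtr_x_le (L := L) hθ ha ε η
    have hy := indicator_gnoWtr_y_le (L := L) hθ ha ε η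
    have hz : gnomonicW η.2.1 ≤ 7200 * (L : ℝ) ^ 6 * F := gnomonicW_z_le (L := L) ha ε η
    -- indicator times power = power of (indicator times weight) since the indicator is `0` or `1`
    have key : ∀ (S : Set ℍ) (w : ℝ), 0 ≤ w → S.indicator (fun _ => (1 : ℝ)) a * w ≤ 7200 * (L : ℝ) ^ 6 / θ * F →
        S.indicator (fun _ => (1 : ℝ)) a * w ^ p ≤ (7200 * (L : ℝ) ^ 6 / θ) ^ p * F ^ p := by
      intro S w hw hle
      by_cases hm : a ∈ S
      · rw [Set.indicator_of_mem hm, one_mul] at hle ⊢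
        rw [← Real.mul_rpow hK0 hF0]
        exact Real.rpow_le_rpow hw hle hp.le
      · rw [Set.indicator_of_notMem hm, zero_mul]
        positivity
    have ex := key _ _ h0x (hx.trans (le_of_eq (by rw [hFdef])))
    have ey := key _ _ h0y ((hy.trans (mul_le_mul_of_nonneg_right hKy hF0)).trans (le_of_eq (by rw [hFdef])))
    have ez : gnomonicW η.2.1 ^ p ≤ (7200 * (L : ℝ) ^ 6 / θ) ^ p * F ^ p := by
      rw [← Real.mul_rpow hK0 hF0]
      exact Real.rpow_le_rpow h0z (hz.trans (mul_le_mul_of_nonneg_right hKz hF0)) hp.le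
    show _ ≤ 3 * (7200 * (L : ℝ) ^ 6 / θ) ^ p * F ^ p
    linarith

/-- ★★★ **GOOD-HUB LEADERS' MOMENTS AT THE A-PRIORI SCALE, UNIFORMLY IN `L`**: ABSOLUTE `C > 0`, `β₁ ≥ 1` with, for EVERY `L ≥ 1`, `b ≥ β₁`,
`0 < θ ≤ 1` and `p > 0`,
`K_L·∫_cone Σ_ε ∫ (𝟙_{θ≤sin²2ψ}W(x)^p + 𝟙_{θ≤sin²ψ}W(y)^p + W(z)^p)·e^{−bF̂₀}ρ ≤ 3·(7200L⁶/θ)^p · e · (C·p·L⁴(1 + log L + log b)/b)^p · Z₀(b)`: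
away from the bad hubs the leaders' transverse weights have all moments of size `(L^{10} log b/(θb))^p`, uniformly in `L` (✓`swap_deficit_rpow_moment_le`);
e.g. `p = 3/2`, `θ = b^{−1/4}`: `O(L^{15}(log b)^{3/2}·b^{−9/8})·Z₀`, so `β·(…) = o(1)·Z₀` on a window — the good-hub cubic moments of memo2 §3.
[cite: Griffiths1964] [cite: Luscher1983, §2] -/
theorem leadersW_rpow_goodHub_term_apriori :
    ∃ C : ℝ, 0 < C ∧ ∃ β₁ : ℝ, 1 ≤ β₁ ∧ ∀ (L : ℕ) [NeZero L] (b : ℝ), β₁ ≤ b → ∀ (θ : ℝ), 0 < θ → θ ≤ 1 → ∀ (p : ℝ), 0 < p →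
      (coneConst ^ 3 / 64 * (1 / (2 * Real.pi ^ 2)) ^ Fintype.card (Fol L)) *
          ∫ a, (∑ ε : GnoSign L, ∫ η : GnoCoord L,
            (Set.indicator {a : ℍ | θ ≤ (2 * (‖a‖⁻¹ * a.re) * (‖a‖⁻¹ * ‖a.im‖)) ^ 2} (fun _ => (1 : ℝ)) a * gnoWtr η.1.1 ^ p +
              Set.indicator {a : ℍ | θ ≤ (‖a‖⁻¹ * ‖a.im‖) ^ 2} (fun _ => (1 : ℝ)) a * gnoWtr η.1.2 ^ p + gnomonicW η.2.1 ^ p) *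
            Real.exp (-(b * gnoDeficit (fun _ => false) (fun _ => 1) a ε η)) * gnoDensity η) ∂coneMeasure ≤
        3 * (7200 * (L : ℝ) ^ 6 / θ) ^ p * (Real.exp 1 * (C * p * (L : ℝ) ^ 4 * (1 + Real.log L + Real.log b) / b) ^ p) *
          ∫ q, Real.exp (-(b * swapRingDeficit L (fun _ => false) q)) ∂(ringMeasure L) := by
  obtain ⟨C, hC, β₁, hβ₁, hmom⟩ := swap_deficit_rpow_moment_le
  refine ⟨C, hC, β₁, hβ₁, fun L _ b hb θ hθ hθ1 p hp => ?_⟩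
  have hb0 : 0 < b := by linarith
  have h1 := leadersW_rpow_goodHub_term_le (L := L) hθ hθ1 hp hb0
  have h2 := hmom L b hb p hp
  have e1 : ∀ q, Real.exp (-b * swapRingDeficit L (fun _ => false) q) = Real.exp (-(b * swapRingDeficit L (fun _ => false) q)) := fun q => by
    rw [neg_mul]
  simp only [e1] at h2
  have hc : (0 : ℝ) ≤ 3 * (7200 * (L : ℝ) ^ 6 / θ) ^ p := by positivity
  exact h1.trans (by nlinarith [mul_le_mul_of_nonneg_left h2 hc])

end GoodHub

end Summit.QuantumFields.YangMills.Theorems.SwapVirialDeficit.BlowUpRing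

end
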